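import Summits.CriticalPhenomena.PercolationContinuityZ3.Theorems.PercNearOneGluingNoHeavyLowerTailKNGoodGMgcCertFast
import HarnessLib

/-!
# THEOREM B certificates — the trilinear condition (B3b), branch `(Φ_α+Φ_δ) / (Q_d+Q₂₃)` (branch `ad`), designee position `j = 3` (core-top), all `r`
# (`NoHeavyLowerTail` cell, stmt-CriticalPhenomena-4575; prover `prim-hp-2`, gen 17)

Support file (`--supports stmt-CriticalPhenomena-4575`, COMPUTATIONAL: three `native_decide` evaluations of the packed check
`KNGoodGMgc.fastTri 3 r true`, ≈ 25 s each: Kronecker-packed big-integer products, `…SBTensKron`).  No definitions, no named facts, no sorries.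
(B3b) of memo MEMO-gen15 §3d, multiplied out (`X·v·w + Y·u·w ≤ G·u·v`, factor table `KNGoodGMgc.facX … facW`): all 4¹² scaled-Bernstein
coefficients of the slack are `≥ 0` (`checkTri`, via `checkTri_of_fastTri`), hence the inequality on `[0,1]¹²` (`tri_of_check`).  The same integers
were computed off-line by three independent implementations (seat gen 15 `trilin3.py` 64 (k,n₁,n₂)-groups per condition; ttrl `hp2b/THMB-BERNSTEIN.md`;
kit job j105771 `cert12` in this single-tensor form: min coefficient exactly `0`, ≈ 1.3–1.6·10⁶ of 4¹² nonzero).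
-/

namespace Summit.CriticalPhenomena.PercolationContinuityZ3.Theorems

namespace KNGoodGMgc

/-- (B3b)-ad, `r = 1`: the scaled-Bernstein check passes (COMPUTATIONAL, packed `native_decide`). [this work] -/
theorem checkTri_3_1_AD : checkTri 3 1 true = true := checkTri_of_fastTri 3 1 true (by native_decide)

/-- (B3b)-ad, `r = 2`: the scaled-Bernstein check passes (COMPUTATIONAL, packed `native_decide`). [this work] -/
theorem checkTri_3_2_AD : checkTri 3 2 true = true := checkTri_of_fastTri 3 2 true (by native_decide)

/-- (B3b)-ad, `r = 3`: the scaled-Bernstein check passes (COMPUTATIONAL, packed `native_decide`). [this work] -/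
theorem checkTri_3_3_AD : checkTri 3 3 true = true := checkTri_of_fastTri 3 3 true (by native_decide)

/-- **(B3b) of THEOREM B, branch `(Φ_α+Φ_δ) / (Q_d+Q₂₃)` (branch `ad`), every pocket reference `r ∈ {1,2,3}`**: `X·v·w + Y·u·w ≤ G·u·v` for all twelve
side parameters in `[0,1]` (memo MEMO-gen15 §3d/§3k). [this work] -/
theorem tri_3_AD (r : ℕ) (hr : r = 1 ∨ r = 2 ∨ r = 3) (x : ℕ → ℝ) (hx : ∀ i, 0 ≤ x i ∧ x i ≤ 1) :
    bexp 11 (facX 3 r true) x * (bexp 12 (qHat (facV 3)) x * bexp 12 (qHat (facW 3 true)) x) +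
        bexp 11 (facY 3 r) x * (bexp 12 (qHat (facU 3 true)) x * bexp 12 (qHat (facW 3 true)) x) ≤
      bexp 11 (facG 3 r true) x * (bexp 12 (qHat (facU 3 true)) x * bexp 12 (qHat (facV 3)) x) := by
  rcases hr with rfl | rfl | rfl
  · exact tri_of_check 3 1 true checkTri_3_1_AD x hx
  · exact tri_of_check 3 2 true checkTri_3_2_AD x hx
  · exact tri_of_check 3 3 true checkTri_3_3_AD x hx

end KNGoodGMgc

end Summit.CriticalPhenomena.PercolationContinuityZ3.Theorems
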